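import Mathlib.Analysis.SpecialFunctions.Trigonometric.Cotangent
import Literature.NumberTheory.EllipticCurves.GaussianLatticeQuarterValues
import HarnessLib

/-!
# The Weierstrass zeta function of `ℤi + ℤ` summed by rows: quasi-periods `π`, `−πi`, and
`Re ζ(z)/π − Re z = Σ_m Re cot π(z − mi)`

Topic `Literature/NumberTheory/EllipticCurves`, the complex-lattice cluster (`WeierstrassZeta`,
`WeierstrassZetaLegendre`, `EisensteinValuesAtI`). Everything here is proved; there are no new
definitions. Throughout, `Λ = ℤi + ℤ` is the lattice of Mathlib's period pair
`PeriodPair.ofUpperHalfPlane UpperHalfPlane.I` (`ω₁ = i`, `ω₂ = 1`) and `ζ = ζ_Λ` is the tree's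
`PeriodPair.weierstrassZeta`, the absolutely convergent Eisenstein series
`ζ(z) = Σ_{w ∈ Λ} (1/(z − w) + 1/w + z/w²)` (junk convention `1/0 = 0`).

Birch and Swinnerton-Dyer (*Notes on elliptic curves. II*, Crelle 218 (1965), §3, p. 85) use
the function "`ξ`, the Weierstrass zeta-function with periods `1, i`" through the facts
"`ξ(u + 1) = ξ(u) + π`, `ξ(u + i) = ξ(u) − πi`" and (3.6) — these are in the tree
(`GaussianLatticeQuarterValues`: `weierstrassZeta_add_one`, `weierstrassZeta_add_I`, `η₁_eq`,
`η₂_eq`; recorded here once more as the quasi-period map `η(mi + n) = π · conj(mi + n)`,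
`weierstrassZeta_add_lattice`) — and through the row-by-row evaluation of the lattice series
that the value of their `L_D(1)` rests on ((3.4)–(3.5)), which is the content of this file:
summing the series over the rows `w = mi + n`, `n ∈ ℤ`, each row is a cotangent (Mathlib's
Mittag-Leffler expansion `cot_series_rep`) plus an explicit correction,

  `Σ_n (1/(z − mi − n) + 1/(mi + n) + z/(mi + n)²) = π cot π(z − mi) + c_m + z d_m`,

where `c_m = lim_N Σ_{|n| ≤ N} 1/(mi + n)` is purely imaginary (`re_sum_Icc_one_div_eq_zero`) and
`d_m = Σ_n (mi + n)⁻²` is real (`im_tsum_one_div_sq_eq_zero`) with `Σ_m d_m = η(1) = π`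
(`tsum_tsum_one_div_sq_eq_pi`; the rows of `ζ(z + 1) − ζ(z)` telescope to `d_m`). Hence, for
`z ∉ Λ` (`hasSum_re_cot`):

  `Re ζ(z)/π − Re z = Σ_{m ∈ ℤ} Re cot π(z − mi)`.

This is the lattice side of the evaluation at `s = 1` of the `L`-series of a weight-one theta
series of `ℤ[i]` (`Literature/NumberTheory/LFunctions/GaussianThetaValueAtOne.lean`), whose
theta side produces the same cotangents (`Re cot π(a + iy) = 2 Σ_{n ≥ 1} sin(2πna) e^{−2πny}`).

## References

* B. J. Birch, H. P. F. Swinnerton-Dyer, *Notes on elliptic curves. II*, J. reine angew. Math.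
  218 (1965) 79–108, §3 (3.4)–(3.6), p. 85 (read on the GDZ scan `PPN243919689_0218`).
* A. Weil, *Elliptic functions according to Eisenstein and Kronecker* (1976), Ch. II–IV
  (Eisenstein summation by rows; `E₁`, `E₂` and the cotangent).
* E. T. Whittaker, G. N. Watson, *A Course of Modern Analysis*, §20.41 (quasi-periods).
-/

noncomputable section

open scoped Classical

open UpperHalfPlane hiding I

open Complex Filter Topology EisensteinSeries SummationFilter Finset

open scoped Real

namespace Literature.NumberTheory.EllipticCurves

namespace GaussianLattice

open PeriodPair

/-! ### Symmetric partial sums over `ℤ` -/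

/-- `Σ_{|n| ≤ N} f(n) = f(0) + Σ_{k < N} (f(k+1) + f(−(k+1)))`. [folklore] -/
theorem sum_Icc_eq_add_sum_range (f : ℤ → ℂ) (N : ℕ) :
    ∑ n ∈ Icc (-(N : ℤ)) N, f n =
      f 0 + ∑ k ∈ range N, (f ((k + 1 : ℕ) : ℤ) + f (-((k + 1 : ℕ) : ℤ))) := by
  induction N with
  | zero => simp
  | succ N ih =>
    rw [Nat.cast_succ, Finset.sum_Icc_succ_eq_add_endpoints, ih, Finset.sum_range_succ]
    push_cast
    ring

/-- The symmetric partial sums of a summable series over `ℤ` converge to its sum. [folklore] -/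
theorem tendsto_sum_Icc_of_summable {f : ℤ → ℂ} (hf : Summable f) :
    Tendsto (fun N : ℕ => ∑ n ∈ Icc (-(N : ℤ)) N, f n) atTop (𝓝 (∑' n, f n)) :=
  hasSum_symmetricIcc_iff.mp (hf.hasSum.mono_left (symmetricIcc ℤ).le_atTop)

/-- **Mittag-Leffler for the cotangent, symmetric form**: for `w ∉ ℤ`,
`Σ_{|n| ≤ N} 1/(w − n) → π cot πw` (Mathlib's `cot_series_rep`). [folklore] -/
theorem tendsto_sum_Icc_one_div_sub {w : ℂ} (hw : w ∈ Complex.integerComplement) :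
    Tendsto (fun N : ℕ => ∑ n ∈ Icc (-(N : ℤ)) N, 1 / (w - n)) atTop
      (𝓝 (π * Complex.cot (π * w))) := by
  have hs := summable_cotTerm hw
  have h1 : Tendsto (fun N : ℕ => ∑ k ∈ range N, cotTerm w k) atTop (𝓝 (∑' k, cotTerm w k)) :=
    hs.hasSum.tendsto_sum_nat
  rw [← cot_series_rep' hw] at h1
  have h3 := h1.const_add (1 / w)
  simp only [add_sub_cancel] at h3
  refine h3.congr fun N => ?_
  rw [sum_Icc_eq_add_sum_range]
  simp only [Int.cast_zero, sub_zero, cotTerm]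
  congr 1
  refine Finset.sum_congr rfl fun k _ => ?_
  push_cast
  ring

/-- `Re (1/(mi + t)) = t/(m² + t²)` for real `t`. [folklore] -/
theorem re_one_div_int_mul_I_add (m : ℤ) (t : ℝ) :
    (1 / ((m : ℂ) * I + t)).re = t / ((m : ℝ) ^ 2 + t ^ 2) := by
  rw [Complex.div_re, Complex.normSq_apply]
  simp
  ring

/-- The symmetric partial sums `Σ_{|n| ≤ N} 1/(mi + n)` are purely imaginary (pair `n` with `−n`;
with the junk value `1/0 = 0` this holds for `m = 0` too). [folklore] -/
theorem re_sum_Icc_one_div_eq_zero (m : ℤ) (N : ℕ) :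
    (∑ n ∈ Icc (-(N : ℤ)) N, 1 / ((m : ℂ) * I + n)).re = 0 := by
  rw [sum_Icc_eq_add_sum_range, Complex.add_re, Complex.re_sum]
  have h0 : (1 / ((m : ℂ) * I + ((0 : ℤ) : ℂ))).re = 0 := by
    have := re_one_div_int_mul_I_add m 0
    simp only [Complex.ofReal_zero, zero_div] at this
    simpa only [Int.cast_zero, Complex.ofReal_zero] using this
  rw [h0, zero_add]
  refine Finset.sum_eq_zero fun k _ => ?_
  have h1 := re_one_div_int_mul_I_add m ((k + 1 : ℕ) : ℝ)
  have h2 := re_one_div_int_mul_I_add m (-((k + 1 : ℕ) : ℝ))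
  rw [Complex.add_re]
  have e1 : (((k + 1 : ℕ) : ℤ) : ℂ) = (((k + 1 : ℕ) : ℝ) : ℂ) := by push_cast; ring
  have e2 : ((-((k + 1 : ℕ) : ℤ) : ℤ) : ℂ) = ((-((k + 1 : ℕ) : ℝ) : ℝ) : ℂ) := by push_cast; ring
  rw [e1, e2, h1, h2]
  ring

/-- The row sums `d_m = Σ_n (mi + n)⁻²` converge absolutely (for every `m`; at `(m, n) = (0, 0)`
the term is the junk value `0`). [folklore] -/
theorem summable_one_div_sq (m : ℤ) : Summable fun n : ℤ => 1 / ((m : ℂ) * I + n) ^ 2 := by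
  refine (linear_right_summable I m (k := 2) le_rfl).congr fun n => ?_
  rw [one_div, zpow_ofNat]

/-- `d_m = Σ_n (mi + n)⁻²` is real (the terms at `n` and `−n` are complex conjugate). [folklore] -/
theorem im_tsum_one_div_sq_eq_zero (m : ℤ) : (∑' n : ℤ, 1 / ((m : ℂ) * I + n) ^ 2).im = 0 := by
  rw [← Complex.conj_eq_iff_im, Complex.conj_tsum]
  rw [show (∑' n : ℤ, (starRingEnd ℂ) (1 / ((m : ℂ) * I + n) ^ 2)) =
      ∑' n : ℤ, 1 / ((m : ℂ) * I + ((Equiv.neg ℤ) n : ℤ)) ^ 2 from ?_]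
  · exact (Equiv.neg ℤ).tsum_eq (fun n : ℤ => 1 / ((m : ℂ) * I + n) ^ 2)
  refine tsum_congr fun n => ?_
  simp only [map_div₀, map_one, map_pow, map_add, map_mul, map_intCast, Complex.conj_I,
    Equiv.neg_apply, Int.cast_neg]
  ring

/-! ### The lattice series summed over `ℤ × ℤ` and by rows -/

/-- The defining series of `ζ_Λ(z)`, indexed by `(m, n) ↦ mi + n`, is summable. [folklore] -/
theorem summable_zetaTerm_prod (z : ℂ) :
    Summable fun p : ℤ × ℤ =>
      1 / (z - (p.1 * I + p.2)) + 1 / (p.1 * I + p.2) + z / (p.1 * I + p.2) ^ 2 := by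
  have h := ((ofUpperHalfPlane UpperHalfPlane.I).hasSum_weierstrassZeta_holds z).summable
  refine (h.comp_injective
    (ofUpperHalfPlane UpperHalfPlane.I).latticeEquivProd.symm.toEquiv.injective).congr fun p => ?_
  simp only [Function.comp_apply, LinearEquiv.coe_toEquiv, PeriodPair.latticeEquiv_symm_apply,
    ofUpperHalfPlane_ω₁, ofUpperHalfPlane_ω₂, UpperHalfPlane.coe_I, mul_one]

/-- `ζ_Λ(z) = Σ_{(m,n) ∈ ℤ²} (1/(z − mi − n) + 1/(mi + n) + z/(mi + n)²)`. [folklore] -/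
theorem hasSum_zetaTerm_prod (z : ℂ) :
    HasSum (fun p : ℤ × ℤ =>
      1 / (z - (p.1 * I + p.2)) + 1 / (p.1 * I + p.2) + z / (p.1 * I + p.2) ^ 2)
      ((ofUpperHalfPlane UpperHalfPlane.I).weierstrassZeta z) := by
  have h := (ofUpperHalfPlane UpperHalfPlane.I).hasSum_weierstrassZeta_holds z
  rw [← (ofUpperHalfPlane UpperHalfPlane.I).latticeEquivProd.symm.toEquiv.hasSum_iff] at h
  refine h.congr_fun fun p => ?_
  simp only [Function.comp_apply, LinearEquiv.coe_toEquiv, PeriodPair.latticeEquiv_symm_apply,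
    ofUpperHalfPlane_ω₁, ofUpperHalfPlane_ω₂, UpperHalfPlane.coe_I, mul_one]

/-- **`ζ_Λ` summed by rows**: `ζ(z) = Σ_m R_m(z)`,
`R_m(z) = Σ_n (1/(z − mi − n) + 1/(mi + n) + z/(mi + n)²)` (fibrewise summation of an
absolutely convergent double series; Weil 1976, Ch. II). [folklore] -/
theorem hasSum_rows (z : ℂ) :
    HasSum (fun m : ℤ => ∑' n : ℤ,
      (1 / (z - (m * I + n)) + 1 / ((m : ℂ) * I + n) + z / ((m : ℂ) * I + n) ^ 2))
      ((ofUpperHalfPlane UpperHalfPlane.I).weierstrassZeta z) := by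
  have hs := summable_zetaTerm_prod z
  have h1 : HasSum (fun m : ℤ => ∑' n : ℤ,
      (1 / (z - (m * I + n)) + 1 / ((m : ℂ) * I + n) + z / ((m : ℂ) * I + n) ^ 2))
      (∑' p : ℤ × ℤ,
        (1 / (z - (p.1 * I + p.2)) + 1 / (p.1 * I + p.2) + z / (p.1 * I + p.2) ^ 2)) := by
    rw [hs.tsum_prod]
    exact hs.prod.hasSum
  rwa [(hasSum_zetaTerm_prod z).tsum_eq] at h1

/-- Each row series converges absolutely. [folklore] -/
theorem summable_row (z : ℂ) (m : ℤ) :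
    Summable fun n : ℤ =>
      1 / (z - (m * I + n)) + 1 / ((m : ℂ) * I + n) + z / ((m : ℂ) * I + n) ^ 2 :=
  (summable_zetaTerm_prod z).prod_factor m

/-- **The rows of `ζ(z + 1) − ζ(z)` telescope**: `R_m(z + 1) − R_m(z) = d_m = Σ_n (mi + n)⁻²`.
[folklore] -/
theorem tsum_row_add_one_sub (z : ℂ) (m : ℤ) :
    ∑' n : ℤ, (1 / (z + 1 - (m * I + n)) + 1 / ((m : ℂ) * I + n) +
        (z + 1) / ((m : ℂ) * I + n) ^ 2) -
      ∑' n : ℤ, (1 / (z - (m * I + n)) + 1 / ((m : ℂ) * I + n) + z / ((m : ℂ) * I + n) ^ 2) =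
      ∑' n : ℤ, 1 / ((m : ℂ) * I + n) ^ 2 := by
  have h1 := summable_row (z + 1) m
  have h2 := summable_row z m
  have hD := summable_one_div_sq m
  set f : ℤ → ℂ := fun n => (z - (m * I + n))⁻¹ with hf
  have hterm : ∀ n : ℤ,
      (1 / (z + 1 - (m * I + n)) + 1 / ((m : ℂ) * I + n) + (z + 1) / ((m : ℂ) * I + n) ^ 2) -
        (1 / (z - (m * I + n)) + 1 / ((m : ℂ) * I + n) + z / ((m : ℂ) * I + n) ^ 2) =
        (f (n - 1) - f n) + 1 / ((m : ℂ) * I + n) ^ 2 := by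
    intro n
    rw [PeriodPair.zetaSummand_shift_sub]
    simp only [f, Int.cast_sub, Int.cast_one, one_div]
    congr 3
    ring
  have hA : Summable fun n : ℤ => f (n - 1) - f n := by
    refine ((h1.sub h2).sub hD).congr fun n => ?_
    simp only [hterm]
    ring
  have htel : ∑' n : ℤ, (f (n - 1) - f n) = 0 := by
    refine PeriodPair.tsum_sub_telescope hA ?_ ?_
    · refine (PeriodPair.tendsto_inv_linear (z - m * I) (-1) (by norm_num)).congr fun N => ?_
      simp only [f, Int.cast_natCast]
      ring_nf
    · refine (PeriodPair.tendsto_inv_linear (z + 1 - m * I) 1 one_ne_zero).congr fun N => ?_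
      simp only [f, Int.cast_sub, Int.cast_neg, Int.cast_natCast, Int.cast_one]
      ring_nf
  calc _ = ∑' n : ℤ, ((1 / (z + 1 - (m * I + n)) + 1 / ((m : ℂ) * I + n) +
            (z + 1) / ((m : ℂ) * I + n) ^ 2) -
          (1 / (z - (m * I + n)) + 1 / ((m : ℂ) * I + n) + z / ((m : ℂ) * I + n) ^ 2)) :=
        (h1.tsum_sub h2).symm
    _ = ∑' n : ℤ, ((f (n - 1) - f n) + 1 / ((m : ℂ) * I + n) ^ 2) := tsum_congr hterm
    _ = 0 + ∑' n : ℤ, 1 / ((m : ℂ) * I + n) ^ 2 := by rw [hA.tsum_add hD, htel]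
    _ = _ := zero_add _

/-! ### Quasi-periods (from `GaussianLatticeQuarterValues`): `ζ(z + mi + n) = ζ(z) + nπ − mπi` -/

/-- **`ζ(z + mi + n) = ζ(z) + nπ − mπi`** for `ℤi + ℤ`: the quasi-period of `mi + n` is
`π · conj(mi + n)` (`η₁ = −πi`, `η₂ = π`, `GaussianLatticeQuarterValues`). [folklore] -/
theorem weierstrassZeta_add_lattice (z : ℂ) (m n : ℤ) :
    (ofUpperHalfPlane UpperHalfPlane.I).weierstrassZeta (z + (m * I + n)) =
      (ofUpperHalfPlane UpperHalfPlane.I).weierstrassZeta z + (n * π - m * π * I) := by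
  have h := (ofUpperHalfPlane UpperHalfPlane.I).weierstrassZeta_add_period m n z
  simp only [ofUpperHalfPlane_ω₁, ofUpperHalfPlane_ω₂, UpperHalfPlane.coe_I, mul_one] at h
  rw [h, η₁_eq, η₂_eq]
  ring

/-! ### `Σ_m d_m = π` -/

/-- The row constants `d_m = Σ_n (mi + n)⁻²` are summable over `m` (rows of
`ζ(z + 1) − ζ(z)`). [folklore] -/
theorem summable_tsum_one_div_sq : Summable fun m : ℤ => ∑' n : ℤ, 1 / ((m : ℂ) * I + n) ^ 2 := by
  refine (((hasSum_rows (0 + 1)).summable).sub (hasSum_rows 0).summable).congr fun m => ?_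
  exact tsum_row_add_one_sub 0 m

/-- **`Σ_m Σ_n (mi + n)⁻² = η(1) = π`** (rows first; this iterated sum is `G₂(i)`).
[folklore] -/
theorem tsum_tsum_one_div_sq_eq_pi : ∑' m : ℤ, ∑' n : ℤ, 1 / ((m : ℂ) * I + n) ^ 2 = (π : ℂ) := by
  have h1 := hasSum_rows ((0 : ℂ) + 1)
  have h0 := hasSum_rows (0 : ℂ)
  calc ∑' m : ℤ, ∑' n : ℤ, 1 / ((m : ℂ) * I + n) ^ 2
      = ∑' m : ℤ, ((∑' n : ℤ, (1 / (0 + 1 - (m * I + n)) + 1 / ((m : ℂ) * I + n) +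
            (0 + 1) / ((m : ℂ) * I + n) ^ 2)) -
          ∑' n : ℤ, (1 / (0 - (m * I + n)) + 1 / ((m : ℂ) * I + n) + 0 / ((m : ℂ) * I + n) ^ 2)) :=
        tsum_congr fun m => (tsum_row_add_one_sub 0 m).symm
    _ = (ofUpperHalfPlane UpperHalfPlane.I).weierstrassZeta (0 + 1) -
          (ofUpperHalfPlane UpperHalfPlane.I).weierstrassZeta 0 := by
        rw [h1.summable.tsum_sub h0.summable, h1.tsum_eq, h0.tsum_eq]
    _ = π := by rw [weierstrassZeta_add_one]; ring

/-! ### Real parts: `Re R_m(z) = π Re cot π(z − mi) + Re z · d_m` -/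

/-- For `z ∉ Λ`, `z − mi ∉ ℤ`. [folklore] -/
theorem sub_int_mul_I_mem_integerComplement {z : ℂ}
    (hz : z ∉ (ofUpperHalfPlane UpperHalfPlane.I).lattice) (m : ℤ) :
    z - m * I ∈ Complex.integerComplement := by
  rw [Complex.mem_integerComplement_iff]
  rintro ⟨k, hk⟩
  apply hz
  rw [mem_lattice_iff]
  exact ⟨m, k, by rw [hk]; ring⟩

/-- **The real part of a row**: for `z ∉ Λ`,
`Re R_m(z) = π Re cot π(z − mi) + Re z · d_m` — the correction `lim Σ_{|n|≤N} 1/(mi + n)` being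
purely imaginary and `d_m` real. [folklore] -/
theorem re_tsum_row {z : ℂ} (hz : z ∉ (ofUpperHalfPlane UpperHalfPlane.I).lattice) (m : ℤ) :
    (∑' n : ℤ, (1 / (z - (m * I + n)) + 1 / ((m : ℂ) * I + n) + z / ((m : ℂ) * I + n) ^ 2)).re =
      π * (Complex.cot (π * (z - m * I))).re +
        z.re * (∑' n : ℤ, 1 / ((m : ℂ) * I + n) ^ 2).re := by
  have hw := sub_int_mul_I_mem_integerComplement hz m
  have hrow := summable_row z m
  have hD := summable_one_div_sq m
  have hsplit : ∀ N : ℕ, ∑ n ∈ Icc (-(N : ℤ)) N,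
      (1 / (z - (m * I + n)) + 1 / ((m : ℂ) * I + n) + z / ((m : ℂ) * I + n) ^ 2) =
      (∑ n ∈ Icc (-(N : ℤ)) N, 1 / (z - m * I - n) +
        ∑ n ∈ Icc (-(N : ℤ)) N, 1 / ((m : ℂ) * I + n)) +
        z * ∑ n ∈ Icc (-(N : ℤ)) N, 1 / ((m : ℂ) * I + n) ^ 2 := by
    intro N
    rw [Finset.mul_sum, ← Finset.sum_add_distrib, ← Finset.sum_add_distrib]
    refine Finset.sum_congr rfl fun n _ => ?_
    rw [sub_sub, mul_one_div]
  have hlim := tendsto_sum_Icc_of_summable hrow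
  have hlimA := tendsto_sum_Icc_one_div_sub hw
  have hlimD := (tendsto_sum_Icc_of_summable hD).const_mul z
  have hre : Tendsto (fun N : ℕ => (∑ n ∈ Icc (-(N : ℤ)) N,
      (1 / (z - (m * I + n)) + 1 / ((m : ℂ) * I + n) + z / ((m : ℂ) * I + n) ^ 2)).re) atTop
      (𝓝 ((π * Complex.cot (π * (z - m * I))).re +
        (z * ∑' n : ℤ, 1 / ((m : ℂ) * I + n) ^ 2).re)) := by
    have h := (Complex.continuous_re.tendsto _).comp (hlimA.add hlimD)
    refine h.congr fun N => ?_
    simp only [Function.comp_apply, hsplit N, Complex.add_re, re_sum_Icc_one_div_eq_zero m N,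
      add_zero]
  have hre' : Tendsto (fun N : ℕ => (∑ n ∈ Icc (-(N : ℤ)) N,
      (1 / (z - (m * I + n)) + 1 / ((m : ℂ) * I + n) + z / ((m : ℂ) * I + n) ^ 2)).re) atTop
      (𝓝 (∑' n : ℤ, (1 / (z - (m * I + n)) + 1 / ((m : ℂ) * I + n) +
        z / ((m : ℂ) * I + n) ^ 2)).re) :=
    (Complex.continuous_re.tendsto _).comp hlim
  rw [tendsto_nhds_unique hre' hre, Complex.re_ofReal_mul, Complex.mul_re,
    im_tsum_one_div_sq_eq_zero, mul_zero, sub_zero]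

/-! ### `Re ζ(z)/π − Re z = Σ_m Re cot π(z − mi)` -/

/-- **Row formula for the real part of `ζ_{ℤi+ℤ}`**: for `z ∉ Λ`,
`Σ_{m ∈ ℤ} Re cot π(z − mi) = Re ζ(z)/π − Re z` (absolutely convergent). [folklore] -/
theorem hasSum_re_cot {z : ℂ} (hz : z ∉ (ofUpperHalfPlane UpperHalfPlane.I).lattice) :
    HasSum (fun m : ℤ => (Complex.cot (π * (z - m * I))).re)
      (((ofUpperHalfPlane UpperHalfPlane.I).weierstrassZeta z).re / π - z.re) := by
  have hR := Complex.hasSum_re (hasSum_rows z)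
  have hD : HasSum (fun m : ℤ => z.re * (∑' n : ℤ, 1 / ((m : ℂ) * I + n) ^ 2).re) (z.re * π) := by
    have h := (Complex.hasSum_re summable_tsum_one_div_sq.hasSum).mul_left z.re
    rwa [tsum_tsum_one_div_sq_eq_pi, Complex.ofReal_re] at h
  have hdiff := hR.sub hD
  have hπ : (π : ℝ) ≠ 0 := Real.pi_ne_zero
  have h3 : HasSum (fun m : ℤ => π * (Complex.cot (π * (z - m * I))).re)
      (((ofUpperHalfPlane UpperHalfPlane.I).weierstrassZeta z).re - z.re * π) := by
    refine hdiff.congr_fun fun m => ?_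
    simp only [re_tsum_row hz m]
    ring
  have h4 : HasSum (fun m : ℤ => (Complex.cot (π * (z - m * I))).re)
      (π⁻¹ * (((ofUpperHalfPlane UpperHalfPlane.I).weierstrassZeta z).re - z.re * π)) := by
    refine (h3.mul_left π⁻¹).congr_fun fun m => ?_
    field_simp
  have e : π⁻¹ * (((ofUpperHalfPlane UpperHalfPlane.I).weierstrassZeta z).re - z.re * π) =
      ((ofUpperHalfPlane UpperHalfPlane.I).weierstrassZeta z).re / π - z.re := by
    field_simp
  rwa [e] at h4

/-- Summability of `m ↦ Re cot π(z − mi)` for `z ∉ Λ`. [folklore] -/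
theorem summable_re_cot {z : ℂ} (hz : z ∉ (ofUpperHalfPlane UpperHalfPlane.I).lattice) :
    Summable fun m : ℤ => (Complex.cot (π * (z - m * I))).re :=
  (hasSum_re_cot hz).summable

/-- The same in coordinates: for real `a, b` with `a + bi ∉ Λ`,
`Σ_{m ∈ ℤ} Re cot π(a + (b + m)i) = Re ζ(a + bi)/π − a`. [folklore] -/
theorem hasSum_re_cot_coord {a b : ℝ}
    (h : (a : ℂ) + b * I ∉ (ofUpperHalfPlane UpperHalfPlane.I).lattice) :
    HasSum (fun m : ℤ => (Complex.cot (π * (a + (b + m) * I))).re)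
      (((ofUpperHalfPlane UpperHalfPlane.I).weierstrassZeta (a + b * I)).re / π - a) := by
  have h1 := hasSum_re_cot h
  rw [← (Equiv.neg ℤ).hasSum_iff] at h1
  simp only [Complex.add_re, Complex.ofReal_re, Complex.mul_re, Complex.ofReal_im, Complex.I_re,
    mul_zero, Complex.I_im, zero_mul, sub_zero, add_zero] at h1
  refine h1.congr_fun fun m => ?_
  simp only [Function.comp_apply, Equiv.neg_apply, Int.cast_neg]
  ring_nf

end GaussianLattice

end Literature.NumberTheory.EllipticCurves

end
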